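import Literature.NumberTheory.EllipticCurves.AnticyclotomicInertiaAboveP
import Literature.NumberTheory.EllipticCurves.Rubin1991.TwoVariableMainConjecture
import Literature.NumberTheory.EllipticCurves.GreenbergSelmer
import Literature.NumberTheory.GaloisRepresentations.AbsGaloisGroupCompact
import Literature.NumberTheory.GaloisRepresentations.LocalGaloisGroupProofs
import HarnessLib

/-!
# The inertia group of the `ℤ_p²`-tower `K̃_∞` at a completely split `p` still surjects onto `𝔽_pˣ`
# under the mod-`p` cyclotomic character (helper for crux `GordTwoRankZeroOffCaseOne`, stmt-BirchSwinnertonDyer-19357,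
# line `three_field_road` v20, stub `stub_tameLocalVanishingR0`; also `tame_roads_mult` / `wan_tame_bdp_road`)

Stub-worker seat `bsd-addord-k1tame-w2` (gen 0). THEOREMS ONLY (no definition, no named fact). BSD is not proved by any
of this.

For a number field `K` Galois over `ℚ`, a prime `p` that splits completely in `K`, a place `w ∣ p` of `K` and ANY two
`ℤ_p`-extensions `κ₁, κ₂ : Γ_K ↠ ℤ_p` (tree `ZpExtension`; `pairKer κ₁ κ₂ = Gal(K̄/K̃_∞)`): for every `a ∈ (ℤ/p)ˣ` there is
an element `σ` of the tree's inertia group `I_w = GreenbergSelmer.inertia w ≤ Γ_K` with `κ₁ σ = κ₂ σ = 1` and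
`χ̄_p(res_{K/ℚ} σ) = a` (`exists_mem_pairKer_inf_inertia_modNCyclotomicCharacter_eq`). Mechanism (Serre, *Local
Fields* IV §4 / Washington §13.1, «`K̃_{∞,w}·ℚ_p^{nr}/ℚ_p^{nr}` is pro-`p`»): the image of the COMPACT local inertia group
`I_{K_w}` under the continuous `(κ₁, κ₂) ∘ res` is a closed, `ℕ`-stable, hence `ℤ_p`-stable subset of `ℤ_p²`
(§1–§2, the argument of `Rank1Residual/Additive/CyclotomicInertiaSqrtPStar` §1–§2 run for a pair over `K`); `χ̄_p ∘ res`
maps `I_w` ONTO `(ℤ/p)ˣ` because `I_w ↦ I_𝔔 ≤ D_𝔔 ≤ res(Γ_K)` at a completely split `p` (§3, tree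
`exists_mem_inertia_modNCyclotomicCharacter_eq`, `SorensenPatching.decompositionSubgroup_le_range_of_ncard_primesOver_eq`,
`comap_inertia_comap_absIntegersMap`, `inertia_adicCompletionPrime_eq_map_absInertia`); and for `t ∈ I_{K_w}` with
`χ̄_p = a` and `t' ∈ I_{K_w}` with `(κ₁,κ₂)(t') = (p−1)⁻¹·(κ₁,κ₂)(t)` the element `s = t·t'^{−(p−1)}` has
`(κ₁,κ₂)(s) = 0` and `χ̄_p(s) = a` (`x^{p−1} = 1` in `(ℤ/p)ˣ`) (§4). §5 records `res(I_w) ≤ I_𝔔` for the contracted prime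
`𝔔 ∣ p` of `\bar ℤ_ℚ`.

References: [SerreLocalFields1979] Ch. IV §4 Prop. 17; [Washington1997] §13.1; [NeukirchANT1999] Ch. I §9, Ch. II §9 (9.6).
-/

set_option linter.dupNamespace false

noncomputable section

open scoped NumberField Pointwise
open Field NumberField IsDedekindDomain
open Literature.NumberTheory.GaloisRepresentations Literature.NumberTheory.EllipticCurves
  Literature.NumberTheory.EllipticCurves.ZpExtension

namespace Summit.BirchSwinnertonDyer.BirchSwinnertonDyer.Theorems.TameLocalVanishing

/-! ### §1 Closed `ℕ`-stable subsets of a topological `ℤ_p`-module are `ℤ_p`-stable -/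

/-- A closed subset of a topological `ℤ_p`-module stable under the natural multiples of `x` contains every
`ℤ_p`-multiple of `x` (`ℕ` is dense in `ℤ_p`, `PadicInt.denseRange_natCast`). [folklore] -/
theorem smul_mem_of_isClosed_of_forall_natCast_smul_mem {p : ℕ} [Fact p.Prime] {M : Type*}
    [AddCommGroup M] [Module ℤ_[p] M] [TopologicalSpace M] [ContinuousSMul ℤ_[p] M] {T : Set M}
    (hT : IsClosed T) {x : M} (hx : ∀ n : ℕ, ((n : ℤ_[p]) • x) ∈ T) (a : ℤ_[p]) : a • x ∈ T := by
  have hcl : IsClosed {a : ℤ_[p] | a • x ∈ T} := hT.preimage (continuous_id.smul continuous_const)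
  have hsub : Set.range (Nat.cast : ℕ → ℤ_[p]) ⊆ {a : ℤ_[p] | a • x ∈ T} := by
    rintro _ ⟨n, rfl⟩
    exact hx n
  have hmem : a ∈ closure (Set.range (Nat.cast : ℕ → ℤ_[p])) := by
    rw [PadicInt.denseRange_natCast.closure_range]
    exact Set.mem_univ a
  exact hcl.closure_subset_iff.mpr hsub hmem

/-! ### §2 The image of a local inertia group under a PAIR of `ℤ_p`-extensions is a `ℤ_p`-submodule -/

section Image

variable {K : Type*} [Field K] [NumberField K] {p : ℕ} [Fact p.Prime]
  (κ₁ κ₂ : ZpExtension K p) (w : HeightOneSpectrum (𝓞 K))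

/-- **The image of the local inertia group `I_{K_w} ≤ Γ_{K_w}` under `(κ₁, κ₂) ∘ res : Γ_{K_w} → Γ_K → ℤ_p²` is a
`ℤ_p`-submodule**: for `σ ∈ I_{K_w}` and `a ∈ ℤ_p` there is `σ' ∈ I_{K_w}` with `κᵢ(res σ') = a·κᵢ(res σ)` for
`i = 1, 2` simultaneously (additive notation). The image is compact (`I_{K_w}` closed in the compact `Γ_{K_w}`), hence
closed, and `ℕ`-stable (`σ ↦ σⁿ`); §1. [folklore] -/
theorem exists_mem_absInertia_pair_eq_mul {σ : absoluteGaloisGroup (w.adicCompletion K)}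
    (hσ : σ ∈ absInertia (w.adicCompletion K)) (a : ℤ_[p]) :
    ∃ σ' ∈ absInertia (w.adicCompletion K),
      Multiplicative.toAdd (κ₁ (absGaloisRestrict K (w.adicCompletion K) σ')) =
          a * Multiplicative.toAdd (κ₁ (absGaloisRestrict K (w.adicCompletion K) σ)) ∧
        Multiplicative.toAdd (κ₂ (absGaloisRestrict K (w.adicCompletion K) σ')) =
          a * Multiplicative.toAdd (κ₂ (absGaloisRestrict K (w.adicCompletion K) σ)) := by
  let f : absoluteGaloisGroup (w.adicCompletion K) → ℤ_[p] × ℤ_[p] := fun g ↦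
    (Multiplicative.toAdd (κ₁ (absGaloisRestrict K (w.adicCompletion K) g)),
      Multiplicative.toAdd (κ₂ (absGaloisRestrict K (w.adicCompletion K) g)))
  have hf : Continuous f := by
    refine Continuous.prodMk ?_ ?_
    · exact continuous_toAdd.comp
        ((map_continuous κ₁).comp (absGaloisRestrict K (w.adicCompletion K)).continuous_toFun)
    · exact continuous_toAdd.comp
        ((map_continuous κ₂).comp (absGaloisRestrict K (w.adicCompletion K)).continuous_toFun)
  haveI : CompactSpace (absoluteGaloisGroup (w.adicCompletion K)) := absoluteGaloisGroup_compactSpace _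
  have hT : IsClosed (f '' (absInertia (w.adicCompletion K) :
      Set (absoluteGaloisGroup (w.adicCompletion K)))) :=
    ((isClosed_absInertia_holds (w.adicCompletion K)).isCompact.image hf).isClosed
  have hx : ∀ n : ℕ, (n : ℤ_[p]) • f σ ∈ f '' (absInertia (w.adicCompletion K) :
      Set (absoluteGaloisGroup (w.adicCompletion K))) := by
    intro n
    refine ⟨σ ^ n, (absInertia _).pow_mem hσ n, ?_⟩
    simp only [f, map_pow, toAdd_pow, Prod.smul_mk, smul_eq_mul, nsmul_eq_mul]
  obtain ⟨σ', hσ', h⟩ := smul_mem_of_isClosed_of_forall_natCast_smul_mem hT hx a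
  refine ⟨σ', hσ', ?_, ?_⟩
  · have h1 := congrArg Prod.fst h
    simpa only [f, Prod.smul_fst, smul_eq_mul] using h1
  · have h2 := congrArg Prod.snd h
    simpa only [f, Prod.smul_snd, smul_eq_mul] using h2

end Image

/-! ### §3 At a completely split `p`, `χ̄_p ∘ res` maps `I_w` onto `(ℤ/p)ˣ` -/

section Split

variable {K : Type*} [Field K] [NumberField K] [IsGalois ℚ K] {p : ℕ} [hp : Fact p.Prime]

omit [IsGalois ℚ K] in
/-- **`res_{K/ℚ}(I_w) ≤ I_𝔔`** for the contraction `𝔔 = 𝔓₀ ∩ \bar ℤ_ℚ` of the prime `𝔓₀ = adicCompletionPrime K w` cut out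
by `K̄ → \bar K_w` (whose inertia group is the tree's `GreenbergSelmer.inertia w`, `inertia_adicCompletionPrime_eq_map_absInertia`).
[cite: NeukirchANT1999, Ch. I §9 (9.4)–(9.6); Ch. II §9 Prop. (9.6)] -/
theorem absGaloisRestrict_mem_inertia_comap_of_mem_inertia {w : HeightOneSpectrum (𝓞 K)}
    {σ : absoluteGaloisGroup K} (hσ : σ ∈ GreenbergSelmer.inertia w) :
    absGaloisRestrict ℚ K σ ∈
      ((adicCompletionPrime K w).comap (absIntegersMap ℚ K)).inertia (absoluteGaloisGroup ℚ) := by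
  have e : GreenbergSelmer.inertia w = (adicCompletionPrime K w).inertia (absoluteGaloisGroup K) :=
    (inertia_adicCompletionPrime_eq_map_absInertia K w).symm
  rw [e] at hσ
  exact absGaloisRestrict_mem_inertia_comap ℚ K hσ

omit [IsGalois ℚ K] in
/-- The contraction `𝔔 = 𝔓₀ ∩ \bar ℤ_ℚ` of `𝔓₀ = adicCompletionPrime K w` lies above the place `u` of `ℚ` below `w`.
[cite: NeukirchANT1999, Ch. I §9] -/
theorem comap_adicCompletionPrime_mem_primesAbove {w : HeightOneSpectrum (𝓞 K)} {u : HeightOneSpectrum (𝓞 ℚ)}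
    (hwu : w.asIdeal.under (𝓞 ℚ) = u.asIdeal) :
    (adicCompletionPrime K w).comap (absIntegersMap ℚ K) ∈ u.primesAbove :=
  comap_absIntegersMap_mem_primesAbove hwu (adicCompletionPrime_mem_primesAbove K w)

/-- **At a completely split `p` the mod-`p` cyclotomic character maps the inertia group `I_w ≤ Γ_K` ONTO `(ℤ/p)ˣ`**:
for every `a ∈ (ℤ/p)ˣ` there is `σ ∈ I_w` with `χ̄_p(res_{K/ℚ} σ) = a`. Proof: `χ̄_p(I_𝔔) = (ℤ/p)ˣ` for the prime `𝔔` of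
`\bar ℤ_ℚ` below `𝔓₀` (`ℚ(ζ_p)/ℚ` totally ramified at `p`, tree `exists_mem_inertia_modNCyclotomicCharacter_eq`);
`I_𝔔 ≤ D_𝔔 ≤ res(Γ_K)` because `(p)` splits completely (`SorensenPatching.decompositionSubgroup_le_range_of_ncard_primesOver_eq`);
and `res⁻¹(I_𝔔) = I_{𝔓₀} = I_w` (`comap_inertia_comap_absIntegersMap`).
[cite: Washington1997, §13.1] [cite: NeukirchANT1999, Ch. I §9 ("`v` splits completely iff `Z_𝔓 = 1`")] -/
theorem exists_mem_inertia_modNCyclotomicCharacter_absGaloisRestrict_eq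
    {u : HeightOneSpectrum (𝓞 ℚ)} (hu : (Rat.HeightOneSpectrum.primesEquiv u : ℕ) = p)
    (hsplit : (u.asIdeal.primesOver (𝓞 K)).ncard = Module.finrank ℚ K)
    {w : HeightOneSpectrum (𝓞 K)} (hwu : w.asIdeal.under (𝓞 ℚ) = u.asIdeal) (a : (ZMod p)ˣ) :
    ∃ σ ∈ GreenbergSelmer.inertia w, modNCyclotomicCharacter ℚ p (absGaloisRestrict ℚ K σ) = a := by
  have hpr : p.Prime := hp.out
  have h𝔔 := comap_adicCompletionPrime_mem_primesAbove (K := K) hwu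
  -- an inertia element `τ ∈ I_𝔔 ≤ Γ_ℚ` with `χ̄_p(τ) = a`
  obtain ⟨τ, hτ, hτa⟩ := exists_mem_inertia_modNCyclotomicCharacter_eq (m := p) (p := p) (k := 0)
    (d := 1) (by rw [zero_add, pow_one, mul_one]) hpr.not_dvd_one hu h𝔔 (a := a)
    (Subsingleton.elim _ _)
  -- `τ ∈ D_𝔔 ≤ res(Γ_K)` since `(p)` splits completely in `K`
  have hτD : τ ∈ ((adicCompletionPrime K w).comap (absIntegersMap ℚ K)).decompositionSubgroup
      (absoluteGaloisGroup ℚ) :=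
    Ideal.inertia_le_decompositionSubgroup _ _ hτ
  obtain ⟨σ, hσ⟩ :=
    SorensenPatching.decompositionSubgroup_le_range_of_ncard_primesOver_eq hsplit h𝔔 hτD
  refine ⟨σ, ?_, by rw [← hτa, ← hσ]; rfl⟩
  -- `σ ∈ res⁻¹(I_𝔔) = I_{𝔓₀} = I_w`
  have hσI : σ ∈ (adicCompletionPrime K w).inertia (absoluteGaloisGroup K) := by
    rw [← comap_inertia_comap_absIntegersMap ℚ K (adicCompletionPrime K w), Subgroup.mem_comap]
    change absGaloisRestrict ℚ K σ ∈ _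
    rw [show absGaloisRestrict ℚ K σ = τ from hσ]
    exact hτ
  rw [show GreenbergSelmer.inertia w = (adicCompletionPrime K w).inertia (absoluteGaloisGroup K) from
    (inertia_adicCompletionPrime_eq_map_absInertia K w).symm]
  exact hσI

/-! ### §4 An element of `Gal(K̄/K̃_∞) ∩ I_w` with prescribed mod-`p` cyclotomic character -/

/-- `p - 1` is a unit of `ℤ_p`. [folklore] -/
theorem isUnit_natCast_sub_one : IsUnit (((p - 1 : ℕ) : ℤ_[p])) := by
  have hpr : p.Prime := hp.out
  have hmem : (p : ℤ_[p]) ∈ nonunits ℤ_[p] := by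
    rw [← IsLocalRing.mem_maximalIdeal, PadicInt.maximalIdeal_eq_span_p]
    exact Ideal.mem_span_singleton_self _
  have h1 : IsUnit (1 - (p : ℤ_[p])) :=
    IsLocalRing.isUnit_one_sub_self_of_mem_nonunits (p : ℤ_[p]) hmem
  have e : ((p - 1 : ℕ) : ℤ_[p]) = -(1 - (p : ℤ_[p])) := by
    rw [Nat.cast_sub hpr.one_le, Nat.cast_one, neg_sub]
  rw [e]
  exact h1.neg

/-- **The inertia group of the `ℤ_p²`-tower at a completely split `p` surjects onto `(ℤ/p)ˣ` under `χ̄_p`.** For `K`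
Galois over `ℚ`, `p` completely split in `K`, a place `w ∣ p`, ANY two `ℤ_p`-extensions `κ₁, κ₂` of `K` and every
`a ∈ (ℤ/p)ˣ`: there is `σ ∈ pairKer κ₁ κ₂ ⊓ I_w` (an element of the inertia group of `K̃_∞ = K̄^{pairKer κ₁ κ₂}` at the
chosen prime above `w`) with `χ̄_p(res_{K/ℚ} σ) = a`. (`K̃_{∞,w}·ℚ_p^{nr}/ℚ_p^{nr}` is pro-`p`, so the tame quotient
`𝔽_pˣ` of the local inertia group survives in `Gal(K̄_w/K̃_{∞,w})`.) Proof: §3 gives `t ∈ I_{K_w}` with `χ̄_p = a`; §2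
gives `t' ∈ I_{K_w}` with `(κ₁,κ₂)(t') = (p−1)⁻¹·(κ₁,κ₂)(t)`; then `s = t·(t'^{p−1})⁻¹` has `κ₁ s = κ₂ s = 1` and
`χ̄_p(s) = a·χ̄_p(t')^{−(p−1)} = a`. [cite: SerreLocalFields1979, Ch. IV §4 Prop. 17] [cite: Washington1997, §13.1] -/
theorem exists_mem_pairKer_inf_inertia_modNCyclotomicCharacter_eq (κ₁ κ₂ : ZpExtension K p)
    {u : HeightOneSpectrum (𝓞 ℚ)} (hu : (Rat.HeightOneSpectrum.primesEquiv u : ℕ) = p)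
    (hsplit : (u.asIdeal.primesOver (𝓞 K)).ncard = Module.finrank ℚ K)
    {w : HeightOneSpectrum (𝓞 K)} (hwu : w.asIdeal.under (𝓞 ℚ) = u.asIdeal) (a : (ZMod p)ˣ) :
    ∃ σ ∈ pairKer κ₁ κ₂ ⊓ GreenbergSelmer.inertia w,
      modNCyclotomicCharacter ℚ p (absGaloisRestrict ℚ K σ) = a := by
  obtain ⟨σ₀, hσ₀, hσ₀a⟩ :=
    exists_mem_inertia_modNCyclotomicCharacter_absGaloisRestrict_eq (K := K) hu hsplit hwu a
  -- `σ₀ = res_w t` with `t ∈ I_{K_w}`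
  obtain ⟨t, ht, rfl⟩ := Subgroup.mem_map.mp hσ₀
  obtain ⟨c, hc⟩ := (isUnit_natCast_sub_one (p := p)).exists_left_inv
  obtain ⟨t', ht', h1, h2⟩ := exists_mem_absInertia_pair_eq_mul κ₁ κ₂ w ht c
  set res := absGaloisRestrict K (w.adicCompletion K) with hres
  have hσ₀a' : modNCyclotomicCharacter ℚ p (absGaloisRestrict ℚ K (res t)) = a := hσ₀a
  have hc' : ((p - 1 : ℕ) : ℤ_[p]) * c = 1 := by rw [mul_comm]; exact hc
  refine ⟨res (t * (t' ^ (p - 1))⁻¹), Subgroup.mem_inf.mpr ⟨?_, ?_⟩, ?_⟩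
  · rw [mem_pairKer_iff]
    refine ⟨?_, ?_⟩
    · apply Multiplicative.toAdd.injective
      rw [map_mul, map_inv, map_pow, map_mul, map_inv, map_pow, toAdd_mul, toAdd_inv, toAdd_pow, h1,
        toAdd_one, nsmul_eq_mul, ← mul_assoc, hc', one_mul, add_neg_cancel]
    · apply Multiplicative.toAdd.injective
      rw [map_mul, map_inv, map_pow, map_mul, map_inv, map_pow, toAdd_mul, toAdd_inv, toAdd_pow, h2,
        toAdd_one, nsmul_eq_mul, ← mul_assoc, hc', one_mul, add_neg_cancel]
  · exact Subgroup.mem_map_of_mem _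
      ((absInertia _).mul_mem ht ((absInertia _).inv_mem ((absInertia _).pow_mem ht' _)))
  · rw [map_mul, map_inv, map_pow, map_mul, map_inv, map_pow, map_mul, map_inv, map_pow, hσ₀a',
      ZMod.units_pow_card_sub_one_eq_one, inv_one, mul_one]

end Split

end Summit.BirchSwinnertonDyer.BirchSwinnertonDyer.Theorems.TameLocalVanishing

end
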